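import Summits.ResolutionOfSingularities.ResolutionOfSingularities.Theorems.MarkedTransferCampaignW46ThreefoldsGammaFreeGlobalSNCAt
import Literature.AlgebraicGeometry.Resolution.MarkedIdealsEtale
import HarnessLib

/-!
# [OURS · L1 W4.6 rung (ii-2), brick B11a] TRANSPORT of the pointwise simple-normal-crossings condition `CampaignW46.SNCAt`
# along open immersions (and étale morphisms): `SNCAt L y` at every `y ∈ U` ⇒ `HasSNC (L|_U)`, and back

Cell res-hironaka, LADDER-RESOLUTION rung L (D-0089), slot W4.6 «restricted-regime rungs of the typed Th. 16.6 procedure»,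
rung (ii) (dimension ladder); brick **B11a** of res-D-pv-049 AS res-L1-s46-pv-11's SPLIT-OFFER 2026-08-27T05:57:54Z (custody
res-plan-2 05:58:37Z / MAP v1.15a, naming res-L1-type-o1 06:01:06Z), seat res-D-pv-041. Host route MarkedTransfer, host item
`HypersurfaceOrderReductionDimLeThree` (stmt-ResolutionOfSingularities-16156); `--kind proof --supports … --as helper`.
Everything here is OURS scheme plumbing over the tree's `Resolution/MarkedIdeals*` library; nothing of H. Hironaka's manuscript
[Hironaka2017] is asserted or used. AI-written; AI review is weaker than expert review.

## What is proved (def-free)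

The consumer is the SNC END-GAME `CampaignW46.orderReducible_of_hasSNC_nhds` (p501980), whose hypothesis is
`HasSNC (L.map fun D => D.comap U.ι)` for an OPEN `U ⊆ X`; the d = 2 loop produces instead the POINTWISE statement
«`SNCAt L y` at every `y ∈ U`» (with `U` the complement of the finite non-snc locus, brick B11b). This file bridges the two.

* `SNCAt.comap_of_etale` — **pointwise étale pull-back**: for `φ : X' → X` flat, unramified and locally of finite type
  (e.g. an open immersion) with `X` locally Noetherian, `SNCAt L (φ x') → SNCAt (L.map (·.comap φ)) x'`. This is the body of
  the tree's `HasSNCWith.comap_of_etale` (`MarkedIdealsEtale.lean`, BGMW Thm. 8.0.5 with Def. 3.1.1) read at ONE point: a regular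
  system of parameters of `𝒪_{X,φ x'}` adapted to the members of `L` through `φ x'` maps under `φ^*_{x'}` to one of `𝒪_{X',x'}`
  (`𝔪_{φ x'}𝒪_{X',x'} = 𝔪_{x'}`, equal dimensions, both regular) adapted to the members of `φ^*L` through `x'`
  (`stalkIdeal_comap_eq_map`, `support_comap`).
* `hasSNC_map_comap_of_forall_sncAt` — hence `(∀ x', SNCAt L (φ x')) → HasSNC (L.map (·.comap φ))`.
* `hasSNC_map_comap_ι_of_forall_sncAt` — **B11a as named** (signature of the SPLIT-OFFER verbatim): for `U : X.Opens`,
  `(∀ y ∈ U, SNCAt L y) → HasSNC (L.map fun D => D.comap U.ι)`.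
* `SNCAt.of_comap_of_isOpenImmersion` — **the converse along an open immersion** `j : U → X` (stalk maps are isomorphisms, so a
  regular system of parameters of `𝒪_{U,y}` pulls BACK): `SNCAt (L.map (·.comap j)) y → SNCAt L (j y)`, PROVIDED distinct members
  of `L` through `j y` stay distinct after restriction (`Set.InjOn (·.comap j) {D | D ∈ L ∧ j y ∈ D.support}`) — without this the
  converse is false (`X = 𝔸¹`, `L = [V(x), V(x(x-1))]`, `U = D(x-1)`, `y = 0`: the two members restrict to the same divisor, so the
  restricted list has snc at `0` while `L` asks for two distinct parameters in a one-dimensional ring); no Noetherian hypothesis.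
* `sncAt_comap_iff_of_isOpenImmersion`, `sncAt_of_hasSNC_map_comap_ι` — the packaged `iff` / `U.ι` forms.

## Sources

* E. Bierstone, D. Grigoriev, P. Milman, J. Włodarczyk, arXiv:1206.3090, Def. 3.1.1, Def. 3.1.5 Remark (1), Thm. 8.0.5.
  [BierstoneGrigorievMilmanWlodarczyk2011]
* H. Matsumura, *Commutative Ring Theory* (1986), Thm. 23.7. [Matsumura1987]
* The Stacks Project, Tag 00UW. [StacksProject]
* H. Hironaka, ms. 2017-03-23 — scope only (slot W4.6 of the campaign), under adjudication, not cited as fact. [Hironaka2017]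
-/

noncomputable section

set_option linter.dupNamespace false -- mandated namespace of this single-conjunct summit

open CategoryTheory AlgebraicGeometry TopologicalSpace IsLocalRing

namespace Summit.ResolutionOfSingularities.ResolutionOfSingularities.Theorems

namespace CampaignW46

open Literature.AlgebraicGeometry.Resolution
open Scheme.IdealSheafData

universe u

/-! ## Pointwise étale pull-back -/

section Etale

variable {X' X : Scheme.{u}} (φ : X' ⟶ X) [Flat φ] [FormallyUnramified φ] [LocallyOfFiniteType φ]

/-- **`SNCAt` pulls back pointwise along étale morphisms** (flat, unramified, locally of finite type; e.g. open immersions):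
if the members of `L` through `φ x'` are cut out by distinct members of a regular system of parameters of the regular local ring
`𝒪_{X,φ x'}`, then the members of `φ^*L = L.map (·.comap φ)` through `x'` are cut out by distinct members of the image system,
which is a regular system of parameters of the regular local ring `𝒪_{X',x'}` (`𝔪_{φ x'}𝒪_{X',x'} = 𝔪_{x'}`, Stacks 00UW;
equal dimensions and regularity, Matsumura 23.7). The body of the tree's `HasSNCWith.comap_of_etale` at one point.
[cite: BierstoneGrigorievMilmanWlodarczyk2011, Def. 3.1.1 with Thm. 8.0.5] -/
theorem SNCAt.comap_of_etale [IsLocallyNoetherian X] {L : List X.IdealSheafData} {x' : X'}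
    (h : SNCAt L (φ x')) : SNCAt (L.map (·.comap φ)) x' := by
  classical
  haveI : IsLocallyNoetherian X' := LocallyOfFiniteType.isLocallyNoetherian φ
  obtain ⟨hreg, u, hu, ι, hι, hιD⟩ := h
  haveI := hreg
  haveI hreg' : IsRegularLocalRing (X'.presheaf.stalk x') :=
    (isRegularLocalRing_stalk_iff_of_etale φ x').mpr hreg
  refine ⟨hreg', ?_⟩
  set f := (φ.stalkMap x').hom with hf
  -- the embedding dimensions agree
  have hrank : (maximalIdeal (X'.presheaf.stalk x')).spanFinrank =
      (maximalIdeal (X.presheaf.stalk (φ x'))).spanFinrank := by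
    have h1 := hreg'.spanFinrank_maximalIdeal
    have h2 := hreg.spanFinrank_maximalIdeal
    rw [ringKrullDim_stalk_eq_of_etale φ x', ← h2] at h1
    exact_mod_cast h1
  let σ : Fin (maximalIdeal (X'.presheaf.stalk x')).spanFinrank ≃
      Fin (maximalIdeal (X.presheaf.stalk (φ x'))).spanFinrank := finCongr hrank
  let u' : Fin (maximalIdeal (X'.presheaf.stalk x')).spanFinrank → X'.presheaf.stalk x' :=
    fun i => f (u (σ i))
  have hu'σ : ∀ j, u' (σ.symm j) = f (u j) := fun j => by
    simp only [u', Equiv.apply_symm_apply]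
  refine ⟨u', ?_, ?_⟩
  · -- `(u') = 𝔪_{x'}`
    have hr : Set.range u' = f '' Set.range u := by
      rw [show u' = (fun j => f (u j)) ∘ σ from rfl, σ.surjective.range_comp]
      exact Set.range_comp f u
    rw [hr, ← Ideal.map_span, hu, hf, map_stalkMap_maximalIdeal]
  · -- the members through `x'` come from members through `φ x'`
    have key : ∀ D' : {D' // D' ∈ L.map (·.comap φ) ∧ x' ∈ D'.support},
        ∃ D : {D // D ∈ L ∧ φ x' ∈ D.support}, D.1.comap φ = D'.1 := by
      rintro ⟨D', hD'L, hx'⟩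
      obtain ⟨D, hDL, rfl⟩ := List.mem_map.mp hD'L
      refine ⟨⟨D, hDL, ?_⟩, rfl⟩
      rw [Scheme.IdealSheafData.support_comap] at hx'
      exact hx'
    choose g hg using key
    refine ⟨fun D' => σ.symm (ι (g D')), ?_, ?_⟩
    · intro D₁ D₂ heq
      have h2 : g D₁ = g D₂ := hι (σ.symm.injective heq)
      apply Subtype.ext
      rw [← hg D₁, ← hg D₂, h2]
    · intro D'
      rw [hu'σ, ← hg D', stalkIdeal_comap_eq_map, hιD (g D'), Ideal.map_span, Set.image_singleton]

/-- **Pointwise snc at every image point gives snc of the pulled-back list**: for `φ : X' → X` flat, unramified and locally of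
finite type with `X` locally Noetherian, `(∀ x', SNCAt L (φ x')) → HasSNC (L.map (·.comap φ))`.
[cite: BierstoneGrigorievMilmanWlodarczyk2011, Def. 3.1.1 with Thm. 8.0.5] -/
theorem hasSNC_map_comap_of_forall_sncAt [IsLocallyNoetherian X] (L : List X.IdealSheafData)
    (h : ∀ x' : X', SNCAt L (φ x')) : HasSNC (L.map (·.comap φ)) :=
  hasSNC_of_forall_sncAt fun x' => (h x').comap_of_etale φ

end Etale

/-! ## B11a: restriction to an open subscheme -/

section Opens

variable {X : Scheme.{u}}

/-- **Brick B11a (TRANSPORT, res-D-pv-049 AS res-L1-s46-pv-11's signature verbatim).** If the boundary list `L` has simple normal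
crossings AT EVERY POINT of the open `U ⊆ X` (`SNCAt L y` for `y ∈ U`), then the restricted list `L|_U = L.map (·.comap U.ι)` has
simple normal crossings on the open subscheme `U` (`HasSNC`), `X` locally Noetherian: the open immersion `U.ι` is étale and
`U.ι x = x.1 ∈ U`. This is the hypothesis shape of the SNC END-GAME `orderReducible_of_hasSNC_nhds` (p501980).
[cite: BierstoneGrigorievMilmanWlodarczyk2011, Def. 3.1.1 with Def. 3.1.5 Remark (1)] -/
theorem hasSNC_map_comap_ι_of_forall_sncAt [IsLocallyNoetherian X] (L : List X.IdealSheafData) (U : X.Opens)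
    (h : ∀ y ∈ (U : Set X), SNCAt L y) : HasSNC (L.map fun D => D.comap U.ι) :=
  hasSNC_map_comap_of_forall_sncAt U.ι L fun x => h (U.ι x) (by rw [Scheme.Opens.ι_apply]; exact x.2)

end Opens

/-! ## The converse along open immersions -/

section OpenImmersion

variable {U X : Scheme.{u}} (j : U ⟶ X) [IsOpenImmersion j]

/-- **`SNCAt` descends pointwise along an open immersion** `j : U → X`, provided distinct members of `L` through `j y` restrict
to distinct ideal sheaves on `U`: the stalk map `𝒪_{X,j y} → 𝒪_{U,y}` is an isomorphism, so a regular system of parameters of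
`𝒪_{U,y}` adapted to `j^*L` pulls back to one of `𝒪_{X,j y}`, and `(j^*D)_y = D_{j y}𝒪_{U,y}` (`stalkIdeal_comap_eq_map`)
identifies the adapted members; injectivity of `D ↦ j^*D` on the members through `j y` is exactly what is needed for distinct
members to receive distinct parameters (and cannot be dropped: `L = [V(x), V(x(x-1))]` on `𝔸¹`, `U = D(x-1)`, `y = 0`). No
Noetherian hypothesis. [cite: BierstoneGrigorievMilmanWlodarczyk2011, Def. 3.1.1 with Def. 3.1.5 Remark (1)] -/
theorem SNCAt.of_comap_of_isOpenImmersion {L : List X.IdealSheafData} {y : U}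
    (hinj : Set.InjOn (fun D : X.IdealSheafData => D.comap j) {D | D ∈ L ∧ j y ∈ D.support})
    (h : SNCAt (L.map (·.comap j)) y) : SNCAt L (j y) := by
  classical
  obtain ⟨hreg', u', hu', ι', hι', hι'D⟩ := h
  -- the stalk isomorphism `e : 𝒪_{X,j y} ≃ 𝒪_{U,y}`
  let e : X.presheaf.stalk (j y) ≃+* U.presheaf.stalk y := (asIso (j.stalkMap y)).commRingCatIsoToRingEquiv
  have he : (e : X.presheaf.stalk (j y) →+* U.presheaf.stalk y) = (j.stalkMap y).hom := rfl
  haveI := hreg'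
  haveI hreg : IsRegularLocalRing (X.presheaf.stalk (j y)) := IsRegularLocalRing.of_ringEquiv e.symm
  refine ⟨hreg, ?_⟩
  -- the embedding dimensions agree
  have hrank : (maximalIdeal (X.presheaf.stalk (j y))).spanFinrank = (maximalIdeal (U.presheaf.stalk y)).spanFinrank := by
    rw [← map_ringEquiv_maximalIdeal e, Ideal.spanFinrank_map_eq_of_ringEquiv]
  let σ : Fin (maximalIdeal (X.presheaf.stalk (j y))).spanFinrank ≃ Fin (maximalIdeal (U.presheaf.stalk y)).spanFinrank :=
    finCongr hrank
  let u : Fin (maximalIdeal (X.presheaf.stalk (j y))).spanFinrank → X.presheaf.stalk (j y) := fun i => e.symm (u' (σ i))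
  have huσ : ∀ k, u (σ.symm k) = e.symm (u' k) := fun k => by
    simp only [u, Equiv.apply_symm_apply]
  refine ⟨u, ?_, ?_⟩
  · -- `(u) = 𝔪_{j y}`
    have hr : Set.range u = e.symm '' Set.range u' := by
      rw [show u = (fun k => e.symm (u' k)) ∘ σ from rfl, σ.surjective.range_comp]
      exact Set.range_comp e.symm u'
    rw [hr, ← Ideal.map_span, hu', map_ringEquiv_maximalIdeal]
  · -- members through `j y` restrict to members through `y`
    have memb : ∀ D : {D // D ∈ L ∧ j y ∈ D.support},
        D.1.comap j ∈ L.map (·.comap j) ∧ y ∈ (D.1.comap j).support := by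
      rintro ⟨D, hDL, hy⟩
      refine ⟨List.mem_map.mpr ⟨D, hDL, rfl⟩, ?_⟩
      rw [Scheme.IdealSheafData.support_comap]
      exact hy
    refine ⟨fun D => σ.symm (ι' ⟨D.1.comap j, memb D⟩), ?_, ?_⟩
    · intro D₁ D₂ heq
      have h2 := congrArg Subtype.val (hι' (σ.symm.injective heq))
      exact Subtype.ext (hinj D₁.2 D₂.2 h2)
    · intro D
      have hD := hι'D ⟨D.1.comap j, memb D⟩
      rw [stalkIdeal_comap_eq_map, ← he] at hD
      have hD' : stalkIdeal D.1 (j y) =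
          (Ideal.span {u' (ι' ⟨D.1.comap j, memb D⟩)}).map (e.symm : U.presheaf.stalk y →+* X.presheaf.stalk (j y)) := by
        rw [← hD, Ideal.map_of_equiv]
      rw [hD', Ideal.map_span, Set.image_singleton, huσ]
      rfl

/-- **`SNCAt` at `j y` versus `SNCAt` of the restricted list at `y`** along an open immersion `j : U → X` (`X` locally
Noetherian), under injectivity of restriction on the members through `j y`.
[cite: BierstoneGrigorievMilmanWlodarczyk2011, Def. 3.1.1 with Def. 3.1.5 Remark (1)] -/
theorem sncAt_comap_iff_of_isOpenImmersion [IsLocallyNoetherian X] {L : List X.IdealSheafData} {y : U}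
    (hinj : Set.InjOn (fun D : X.IdealSheafData => D.comap j) {D | D ∈ L ∧ j y ∈ D.support}) :
    SNCAt (L.map (·.comap j)) y ↔ SNCAt L (j y) :=
  ⟨SNCAt.of_comap_of_isOpenImmersion j hinj, fun h => h.comap_of_etale j⟩

/-- **Converse of B11a at a point.** If the restricted list `L.map (·.comap U.ι)` has simple normal crossings on the open
subscheme `U` and distinct members of `L` through `y ∈ U` restrict to distinct ideal sheaves on `U`, then `SNCAt L y`.
[cite: BierstoneGrigorievMilmanWlodarczyk2011, Def. 3.1.1 with Def. 3.1.5 Remark (1)] -/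
theorem sncAt_of_hasSNC_map_comap_ι {X : Scheme.{u}} (L : List X.IdealSheafData) (U : X.Opens)
    (h : HasSNC (L.map fun D => D.comap U.ι)) {y : X} (hy : y ∈ U)
    (hinj : Set.InjOn (fun D : X.IdealSheafData => D.comap U.ι) {D | D ∈ L ∧ y ∈ D.support}) : SNCAt L y := by
  have h' : SNCAt (L.map fun D => D.comap U.ι) (⟨y, hy⟩ : U) := HasSNC.sncAt h ⟨y, hy⟩
  exact SNCAt.of_comap_of_isOpenImmersion U.ι (y := ⟨y, hy⟩) hinj h'

end OpenImmersion

end CampaignW46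

end Summit.ResolutionOfSingularities.ResolutionOfSingularities.Theorems

end
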